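import Literature.AlgebraicGeometry.Milne1999.LefschetzGroupExteriorAction
import Literature.AlgebraicGeometry.Milne1999.LefschetzGroupOneIsogenyFactors
import HarnessLib

/-!
# The family carriers of Milne's `L(A)` and `ker l(A)`: exterior structure with no dimension hypothesis,
# Thm. 4.4 as a membership criterion and as group isomorphisms, Cor. 4.7 and isogeny invariance for the groups themselves

Sequel to `Milne1999/LefschetzGroupExteriorAction` (an element of `ker l(A)(ℂ)` acts on `Hᵏ(A(ℂ); ℂ) = ⋀ᵏH¹` through `⋀ᵏ` of
its `H¹`-component).  Milne [Def. 4.3, p. 659] has `L(A) ⊂ GL(V(A)) × 𝔾_m` act on `H^*(A^r) = ⋀^*(V(A)^∨)^{⊕ r}` through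
`V(A)`; the tree's `lefschetzGroup n X` / `specialLefschetzGroup n X` (`Milne1999/LefschetzGroup`) are families on `⊕ₖ Hᵏ`
admitting Künneth extensions scaling / fixing the Lefschetz classes of all powers.

* §1 **`L(A)(ℂ)` also acts through `⋀•` of `H¹`, in every dimension** — `L = w(𝔾_m)·ker l` (`l ∘ w = -2`, p. 659) and
  `⋀ᵏ(c·u) = cᵏ ⋀ᵏu` (`exteriorPullback_smul_apply`): `lefschetzGroup_apply_cupPowOne`, `lefschetzGroup_apply_eq_exteriorPullback`,
  `lefschetzGroup_map_cupProduct`, `(special)lefschetzGroup_eq_exteriorPullbackEquiv`, hence **`lefschetzGroup_ext_one'`** and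
  `bijective_evalOne_subgroupMap_lefschetzGroup'` with NO hypothesis on `dim A` (the unprimed versions of
  `LefschetzGroupExteriorAction` assume `dim A ≥ 1`), and the Künneth family of `g ∈ L(A)(ℂ)` is `⋀•(g₁^{⊕(a+1)})`
  (`kunnethFamily_eq_exteriorKunnethFamily_of_mem_lefschetzGroup`, the tree's `exteriorKunnethFamily`).
* §2 **Thm. 4.4 in full on the carriers**: for a polarization class `h` (`IsPolarizationClass`, `dim A ≥ 1`) or a rational class
  with a Kähler multiple, `(⋀ᵏu)_k ∈ ker l(A)(ℂ) ↔ u ∈ S(A)(h)(ℂ)` (`…exteriorPullbackEquiv_mem_specialLefschetzGroup_iff…`),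
  `(⋀ᵏu)_k ∈ L(A)(ℂ) ↔ u ∈ G(A)(h)(ℂ)`, and `g ∈ ker l ↔ g₁ ∈ S(A)(h) ∧ g = (⋀ᵏg₁)_k`, `g ∈ L ↔ g₁ ∈ G(A)(h) ∧ g = (⋀ᵏg₁)_k`
  (`IsPolarizationClass.mem_specialLefschetzGroup_iff`, `IsPolarizationClass.mem_lefschetzGroup_iff`); `ker l ≤ MT` iff
  `ker l|_{H¹} ≤ MT|_{H¹}` without the dimension hypothesis (`specialLefschetzGroup_le_mumfordTateGroup_iff_map_le'`).
* §3 **the groups as abstract groups**: `ker l(A)(ℂ) ≅ S(A)(h)(ℂ)`, `L(A)(ℂ) ≅ G(A)(h)(ℂ)` (Thm. 4.4); Cor. 4.7 for the family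
  carriers — `ker l(A^{r+1}) ≅ ker l(A)`, `L(A^{r+1}) ≅ L(A)`, `ker l(B × C) ≅ ker l(B) × ker l(C)` and `L(B × C) ≅ G(B) ×_{𝔾_m} G(C)`
  for Hom-orthogonal factors; isogeny invariance `ker l(A) ≅ ker l(B)`, `L(A) ≅ L(B)`; and the Prop. 1.5 combinations
  (`X ∼ A^{r+1}`, `X ∼ B^{r+1} × C^{s+1}`) — all from the `H¹`-level isomorphisms of `LefschetzGroupOnePowers`,
  `LefschetzGroupOneProducts`, `LefschetzGroupOneIsogeny(Factors)` composed with `g ↦ g₁`.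

## References

* [Milne1999LefschetzClasses] J. S. Milne, Lefschetz classes on abelian varieties, Duke Math. J. 96 (1999) 639–675,
  §1 Prop. 1.5 (p. 644), §4 Def. 4.3, Thm. 4.4, Cor. 4.5, Def. 4.6, Cor. 4.7, Prop. 4.8 (pp. 657–660), p. 659 (`l ∘ w = -2`).
* [HatcherAT2002] A. Hatcher, Algebraic Topology, CUP 2002, §3.2 Prop. 3.10, Example 3.16.
* [MumfordAV1970] D. Mumford, Abelian Varieties, 1970, §19 (isogenies act invertibly on `H¹(-, ℚ)`).
-/

noncomputable section

open CategoryTheory MonoidalCategory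
open Literature.AlgebraicTopology.SingularHomology
open Literature.AlgebraicGeometry.Motives
open Literature.AlgebraicGeometry.HodgeTheory

namespace Literature.AlgebraicGeometry.Milne1999

/-! ### §1 `L(A)(ℂ)` acts through `⋀•` of `H¹`, in every dimension -/

section ExteriorL

variable {A : AbelianVariety ℂ} {gA gA' : ∀ k : ℕ, complexBetti A.X k ≃ₗ[ℂ] complexBetti A.X k}

/-- `⋀ᵈ(c·L) = cᵈ · ⋀ᵈL` (multilinearity of `v₀ ∪ ⋯ ∪ v_{d-1}`). [cite: HatcherAT2002, §3.2 Example 3.16] -/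
theorem exteriorPullback_smul_apply (c : ℂ) (L : complexBetti A.X 1 →ₗ[ℂ] complexBetti A.X 1) (d : ℕ) (x : complexBetti A.X d) :
    exteriorPullback (AbelianVariety.hasExteriorCohomologyH1_complexPoints A) (c • L) d x =
      c ^ d • exteriorPullback (AbelianVariety.hasExteriorCohomologyH1_complexPoints A) L d x := by
  have hΛ := AbelianVariety.hasExteriorCohomologyH1_complexPoints A
  have key : exteriorPullback hΛ (c • L) d = c ^ d • exteriorPullback hΛ L d := by
    refine exteriorPullback_ext hΛ fun v ↦ ?_
    rw [exteriorPullback_cupPowOne, LinearMap.smul_apply, exteriorPullback_cupPowOne]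
    have e : (fun i ↦ (c • L) (v i)) = fun i ↦ (fun _ : Fin d ↦ c) i • (fun i ↦ L (v i)) i := by
      funext i; rfl
    rw [e, MultilinearMap.map_smul_univ, Finset.prod_const, Finset.card_univ, Fintype.card_fin]
  exact LinearMap.congr_fun key x

/-- **Milne's `L(A)(ℂ)` acts on `Hᵏ(A(ℂ); ℂ)` through `⋀ᵏ` of its `H¹`-component, in every dimension**: for `g ∈ lefschetzGroup`,
`g_k(v₁ ∪ ⋯ ∪ v_k) = g₁v₁ ∪ ⋯ ∪ g₁v_k` — write `g = w(c)·s` with `s ∈ ker l` (`L = w(𝔾_m)·ker l`); `s` acts through `⋀ᵏ`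
(`specialLefschetzGroup_apply_cupPowOne`) and `w(c)` by `cᵏ = ∏ c`. [cite: Milne1999LefschetzClasses, Def. 4.3, Thm. 4.4 and p. 659 (l ∘ w = -2)] -/
theorem lefschetzGroup_apply_cupPowOne (hg : gA ∈ lefschetzGroup A.dim A.X) (k : ℕ) (v : Fin k → complexBetti A.X 1) :
    gA k (cupPowOne ℂ (ComplexPoints A.X) k v) = cupPowOne ℂ (ComplexPoints A.X) k (fun j ↦ gA 1 (v j)) := by
  obtain ⟨c, s, hs, rfl⟩ := mem_lefschetzGroup_iff_exists_weightCocharacter_mul.1 hg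
  rw [Pi.mul_apply, LinearEquiv.mul_apply, specialLefschetzGroup_apply_cupPowOne hs, weightCocharacter_apply]
  have e : (fun j ↦ (weightCocharacter A.X c * s) 1 (v j)) = fun j ↦ (fun _ : Fin k ↦ (c : ℂ)) j • (fun j ↦ s 1 (v j)) j := by
    funext j
    rw [Pi.mul_apply, LinearEquiv.mul_apply, weightCocharacter_apply, pow_one]
  rw [e, MultilinearMap.map_smul_univ, Finset.prod_const, Finset.card_univ, Fintype.card_fin]

/-- `g_k = ⋀ᵏ(g₁)` for `g ∈ L(A)(ℂ)`, read through `exteriorPullback`. [cite: Milne1999LefschetzClasses, Def. 4.3 (p. 659)] -/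
theorem lefschetzGroup_apply_eq_exteriorPullback (hg : gA ∈ lefschetzGroup A.dim A.X) (k : ℕ) (x : complexBetti A.X k) :
    gA k x = exteriorPullback (AbelianVariety.hasExteriorCohomologyH1_complexPoints A)
      (gA 1 : complexBetti A.X 1 →ₗ[ℂ] complexBetti A.X 1) k x := by
  have hΛ := AbelianVariety.hasExteriorCohomologyH1_complexPoints A
  have key : (gA k : complexBetti A.X k →ₗ[ℂ] complexBetti A.X k) =
      exteriorPullback hΛ (gA 1 : complexBetti A.X 1 →ₗ[ℂ] complexBetti A.X 1) k := by
    refine exteriorPullback_ext hΛ fun v ↦ ?_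
    rw [LinearEquiv.coe_coe, lefschetzGroup_apply_cupPowOne hg, exteriorPullback_cupPowOne]
    rfl
  exact LinearMap.congr_fun key x

/-- **`L(A)(ℂ)` acts multiplicatively on `H•(A(ℂ); ℂ)`**: `g(x ∪ y) = g x ∪ g y`. [cite: Milne1999LefschetzClasses, Def. 4.3 (p. 659)] [cite: HatcherAT2002, §3.2 Prop. 3.10] -/
theorem lefschetzGroup_map_cupProduct (hg : gA ∈ lefschetzGroup A.dim A.X) {i j k : ℕ} (h : i + j = k)
    (x : complexBetti A.X i) (y : complexBetti A.X j) :
    gA k (cupProduct h x y) = cupProduct h (gA i x) (gA j y) := by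
  rw [lefschetzGroup_apply_eq_exteriorPullback hg k, lefschetzGroup_apply_eq_exteriorPullback hg i,
    lefschetzGroup_apply_eq_exteriorPullback hg j, exteriorPullback_cupProduct]

/-- `g = (⋀ᵏg₁)_k` for `g ∈ L(A)(ℂ)` (the tree's `exteriorPullbackEquiv`). [cite: Milne1999LefschetzClasses, Def. 4.3 (p. 659)] -/
theorem lefschetzGroup_eq_exteriorPullbackEquiv (hg : gA ∈ lefschetzGroup A.dim A.X) :
    gA = fun k ↦ exteriorPullbackEquiv (AbelianVariety.hasExteriorCohomologyH1_complexPoints A) (gA 1) k := by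
  funext k
  refine LinearEquiv.toLinearMap_injective ?_
  rw [coe_exteriorPullbackEquiv]
  exact LinearMap.ext fun x ↦ lefschetzGroup_apply_eq_exteriorPullback hg k x

/-- `g = (⋀ᵏg₁)_k` for `g ∈ ker l(A)(ℂ)`. [cite: Milne1999LefschetzClasses, Def. 4.3 and Thm. 4.4 (p. 659)] -/
theorem specialLefschetzGroup_eq_exteriorPullbackEquiv (hg : gA ∈ specialLefschetzGroup A.dim A.X) :
    gA = fun k ↦ exteriorPullbackEquiv (AbelianVariety.hasExteriorCohomologyH1_complexPoints A) (gA 1) k :=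
  lefschetzGroup_eq_exteriorPullbackEquiv (specialLefschetzGroup_le_lefschetzGroup hg)

/-- **An element of `L(A)(ℂ)` is determined by its degree-one component, in every dimension** (the version of
`lefschetzGroup_ext_one` without `dim A ≥ 1`). [cite: Milne1999LefschetzClasses, Def. 4.3 (p. 659)] -/
theorem lefschetzGroup_ext_one' (hg : gA ∈ lefschetzGroup A.dim A.X) (hg' : gA' ∈ lefschetzGroup A.dim A.X)
    (h1 : gA 1 = gA' 1) : gA = gA' := by
  rw [lefschetzGroup_eq_exteriorPullbackEquiv hg, lefschetzGroup_eq_exteriorPullbackEquiv hg', h1]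

/-- **`L(A)(ℂ) ≅ L(A)(ℂ)|_{H¹}`, `g ↦ g₁`, in every dimension** (bijectivity of the evaluation at degree one).
[cite: Milne1999LefschetzClasses, Def. 4.3 (p. 659)] -/
theorem bijective_evalOne_subgroupMap_lefschetzGroup' (A : AbelianVariety ℂ) :
    Function.Bijective ((Pi.evalMonoidHom (fun k : ℕ ↦ complexBetti A.X k ≃ₗ[ℂ] complexBetti A.X k) 1).subgroupMap
      (lefschetzGroup A.dim A.X)) := by
  refine ⟨?_, MonoidHom.subgroupMap_surjective _ _⟩
  rintro ⟨g, hg⟩ ⟨g', hg'⟩ e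
  exact Subtype.ext (lefschetzGroup_ext_one' hg hg' (congrArg Subtype.val e))

/-- `L(A)(ℂ) ≅ L(A)(ℂ)|_{H¹}` as abstract groups, in every dimension. [cite: Milne1999LefschetzClasses, Def. 4.3 (p. 659)] -/
theorem nonempty_lefschetzGroup_mulEquiv_map_one' (A : AbelianVariety ℂ) :
    Nonempty (lefschetzGroup A.dim A.X ≃*
      (lefschetzGroup A.dim A.X).map (Pi.evalMonoidHom (fun k : ℕ ↦ complexBetti A.X k ≃ₗ[ℂ] complexBetti A.X k) 1)) :=
  ⟨MulEquiv.ofBijective _ (bijective_evalOne_subgroupMap_lefschetzGroup' A)⟩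

/-- **The Künneth family of `g ∈ L(A)(ℂ)` is `⋀•(g₁^{⊕(a+1)})`** (the tree's `exteriorKunnethFamily A (g 1)`): uniqueness of
Künneth families (`IsKunnethFamily.ext_of_apply_zero`). [cite: Milne1999LefschetzClasses, Def. 4.3 (p. 659)] [cite: HatcherAT2002, §3.2 Thm. 3.16] -/
theorem kunnethFamily_eq_exteriorKunnethFamily_of_mem_lefschetzGroup (hg : gA ∈ lefschetzGroup A.dim A.X)
    {G : ∀ a k : ℕ, complexBetti (cartesianPow A.X (a + 1)) k ≃ₗ[ℂ] complexBetti (cartesianPow A.X (a + 1)) k}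
    (hG : IsKunnethFamily A.X G) (h0 : G 0 = gA) : G = exteriorKunnethFamily A (gA 1) :=
  IsKunnethFamily.ext_of_apply_zero AbelianVariety.isSmoothProjective_holds hG (isKunnethFamily_exteriorKunnethFamily A (gA 1))
    (h0.trans ((lefschetzGroup_eq_exteriorPullbackEquiv hg).trans (exteriorKunnethFamily_zero A (gA 1)).symm))

/-- The Künneth family of `g ∈ ker l(A)(ℂ)` is `⋀•(g₁^{⊕(a+1)})`. [cite: Milne1999LefschetzClasses, Def. 4.3 and Thm. 4.4 (p. 659)] -/
theorem kunnethFamily_eq_exteriorKunnethFamily_of_mem_specialLefschetzGroup (hg : gA ∈ specialLefschetzGroup A.dim A.X)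
    {G : ∀ a k : ℕ, complexBetti (cartesianPow A.X (a + 1)) k ≃ₗ[ℂ] complexBetti (cartesianPow A.X (a + 1)) k}
    (hG : IsKunnethFamily A.X G) (h0 : G 0 = gA) : G = exteriorKunnethFamily A (gA 1) :=
  kunnethFamily_eq_exteriorKunnethFamily_of_mem_lefschetzGroup (specialLefschetzGroup_le_lefschetzGroup hg) hG h0

/-- **`ker l(A) ≤ MT(A)` (families) iff `ker l(A)|_{H¹} ≤ MT(A)|_{H¹}`, in every dimension** (the version of
`specialLefschetzGroup_le_mumfordTateGroup_iff_map_le` without `dim A ≥ 1`). [cite: Milne1999LefschetzClasses, §4 pp. 659–660] -/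
theorem specialLefschetzGroup_le_mumfordTateGroup_iff_map_le' (A : AbelianVariety ℂ) :
    specialLefschetzGroup A.dim A.X ≤ mumfordTateGroup A.dim A.X ↔
      (specialLefschetzGroup A.dim A.X).map (Pi.evalMonoidHom (fun k : ℕ ↦ complexBetti A.X k ≃ₗ[ℂ] complexBetti A.X k) 1) ≤
        (mumfordTateGroup A.dim A.X).map (Pi.evalMonoidHom (fun k : ℕ ↦ complexBetti A.X k ≃ₗ[ℂ] complexBetti A.X k) 1) := by
  refine ⟨fun h ↦ Subgroup.map_mono h, fun h s hs ↦ ?_⟩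
  obtain ⟨m, hm, e⟩ := h ⟨s, hs, rfl⟩
  have hsm : m = s := lefschetzGroup_ext_one' ((AbelianVariety.hodgeGroup_le_specialLefschetzGroup A).2 hm)
    (specialLefschetzGroup_le_lefschetzGroup hs) e
  exact hsm ▸ hm

end ExteriorL

/-! ### §2 Thm. 4.4 in full on the carriers: membership criteria -/

section Membership

variable {A : AbelianVariety ℂ} {h : complexBetti A.X 2} {gA : ∀ k : ℕ, complexBetti A.X k ≃ₗ[ℂ] complexBetti A.X k}
  {u : complexBetti A.X 1 ≃ₗ[ℂ] complexBetti A.X 1}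

/-- `(⋀ᵏu)_k ∈ ker l(A)(ℂ) ↔ u ∈ ker l(A)(ℂ)|_{H¹}`. [cite: Milne1999LefschetzClasses, Def. 4.3 and Thm. 4.4 (p. 659)] -/
theorem exteriorPullbackEquiv_mem_specialLefschetzGroup_iff_mem_map :
    (fun k ↦ exteriorPullbackEquiv (AbelianVariety.hasExteriorCohomologyH1_complexPoints A) u k) ∈ specialLefschetzGroup A.dim A.X ↔
      u ∈ (specialLefschetzGroup A.dim A.X).map
        (Pi.evalMonoidHom (fun k : ℕ ↦ complexBetti A.X k ≃ₗ[ℂ] complexBetti A.X k) 1) := by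
  constructor
  · intro hu
    exact ⟨_, hu, exteriorPullbackEquiv_one_eq _ u⟩
  · rintro ⟨g, hg, rfl⟩
    have e := specialLefschetzGroup_eq_exteriorPullbackEquiv hg
    change (fun k ↦ exteriorPullbackEquiv (AbelianVariety.hasExteriorCohomologyH1_complexPoints A) (g 1) k) ∈ _
    rw [← e]
    exact hg

/-- `(⋀ᵏu)_k ∈ L(A)(ℂ) ↔ u ∈ L(A)(ℂ)|_{H¹}`. [cite: Milne1999LefschetzClasses, Def. 4.3 (p. 659)] -/
theorem exteriorPullbackEquiv_mem_lefschetzGroup_iff_mem_map :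
    (fun k ↦ exteriorPullbackEquiv (AbelianVariety.hasExteriorCohomologyH1_complexPoints A) u k) ∈ lefschetzGroup A.dim A.X ↔
      u ∈ (lefschetzGroup A.dim A.X).map
        (Pi.evalMonoidHom (fun k : ℕ ↦ complexBetti A.X k ≃ₗ[ℂ] complexBetti A.X k) 1) := by
  constructor
  · intro hu
    exact ⟨_, hu, exteriorPullbackEquiv_one_eq _ u⟩
  · rintro ⟨g, hg, rfl⟩
    have e := lefschetzGroup_eq_exteriorPullbackEquiv hg
    change (fun k ↦ exteriorPullbackEquiv (AbelianVariety.hasExteriorCohomologyH1_complexPoints A) (g 1) k) ∈ _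
    rw [← e]
    exact hg

/-- **Milne's Thm. 4.4 in full, for a rational class with a Kähler multiple: `(⋀ᵏu)_k ∈ ker l(A)(ℂ) ↔ u ∈ S(A)(h)(ℂ)`**
(`u ∈ C(A) ⊗ ℂ` with `u†u = 1`, read on `H¹`; every dimension). [cite: Milne1999LefschetzClasses, Thm. 4.4 (p. 659)] -/
theorem exteriorPullbackEquiv_mem_specialLefschetzGroup_iff_of_isKaehlerClass (hQ : IsRationalClass h)
    (hK : ∃ s : ℝ, 0 < s ∧ IsKaehlerClass A.dim A.X ((s : ℂ) • h)) :
    (fun k ↦ exteriorPullbackEquiv (AbelianVariety.hasExteriorCohomologyH1_complexPoints A) u k) ∈ specialLefschetzGroup A.dim A.X ↔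
      u ∈ unitaryCentralizerGroup A h := by
  rw [exteriorPullbackEquiv_mem_specialLefschetzGroup_iff_mem_map,
    Milne1999_thm44_specialLefschetzGroup_one_eq_unitaryCentralizerGroup_holds A h hQ hK]

/-- **Milne's Thm. 4.4 in full, for a polarization class: `(⋀ᵏu)_k ∈ ker l(A)(ℂ) ↔ u ∈ S(A)(h)(ℂ)`** (`dim A ≥ 1`).
[cite: Milne1999LefschetzClasses, Thm. 4.4 (p. 659)] -/
theorem _root_.Literature.AlgebraicGeometry.HodgeTheory.IsPolarizationClass.exteriorPullbackEquiv_mem_specialLefschetzGroup_iff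
    (hpol : IsPolarizationClass A.dim A.X h) (hA : 1 ≤ A.dim) :
    (fun k ↦ exteriorPullbackEquiv (AbelianVariety.hasExteriorCohomologyH1_complexPoints A) u k) ∈ specialLefschetzGroup A.dim A.X ↔
      u ∈ unitaryCentralizerGroup A h := by
  rw [exteriorPullbackEquiv_mem_specialLefschetzGroup_iff_mem_map, hpol.specialLefschetzGroup_map_one_eq hA]

/-- **`(⋀ᵏu)_k ∈ L(A)(ℂ) ↔ u ∈ G(A)(h)(ℂ)`** (`u ∈ C(A) ⊗ ℂ` with `u†u ∈ ℂˣ`; polarization class, `dim A ≥ 1`).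
[cite: Milne1999LefschetzClasses, Def. 4.3, Thm. 4.4 and §4 p. 659] -/
theorem _root_.Literature.AlgebraicGeometry.HodgeTheory.IsPolarizationClass.exteriorPullbackEquiv_mem_lefschetzGroup_iff
    (hpol : IsPolarizationClass A.dim A.X h) (hA : 1 ≤ A.dim) :
    (fun k ↦ exteriorPullbackEquiv (AbelianVariety.hasExteriorCohomologyH1_complexPoints A) u k) ∈ lefschetzGroup A.dim A.X ↔
      u ∈ similitudeCentralizerGroup A h := by
  rw [exteriorPullbackEquiv_mem_lefschetzGroup_iff_mem_map, hpol.lefschetzGroup_map_one_eq hA]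

/-- **`g ∈ ker l(A)(ℂ)` iff `g₁ ∈ S(A)(h)(ℂ)` and `g = (⋀ᵏg₁)_k`** (polarization class, `dim A ≥ 1`): the tree's family carrier
`specialLefschetzGroup` IS Milne's `S(A)` on `ℂ`-points acting through `⋀•` of `H¹`. [cite: Milne1999LefschetzClasses, Def. 4.3 and Thm. 4.4 (p. 659)] -/
theorem _root_.Literature.AlgebraicGeometry.HodgeTheory.IsPolarizationClass.mem_specialLefschetzGroup_iff
    (hpol : IsPolarizationClass A.dim A.X h) (hA : 1 ≤ A.dim) :
    gA ∈ specialLefschetzGroup A.dim A.X ↔ gA 1 ∈ unitaryCentralizerGroup A h ∧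
      gA = fun k ↦ exteriorPullbackEquiv (AbelianVariety.hasExteriorCohomologyH1_complexPoints A) (gA 1) k := by
  constructor
  · intro hg
    exact ⟨(hpol.specialLefschetzGroup_map_one_eq hA).le ⟨gA, hg, rfl⟩, specialLefschetzGroup_eq_exteriorPullbackEquiv hg⟩
  · rintro ⟨h1, e⟩
    rw [e]
    exact (hpol.exteriorPullbackEquiv_mem_specialLefschetzGroup_iff hA).2 h1

/-- **`g ∈ L(A)(ℂ)` iff `g₁ ∈ G(A)(h)(ℂ)` and `g = (⋀ᵏg₁)_k`** (polarization class, `dim A ≥ 1`).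
[cite: Milne1999LefschetzClasses, Def. 4.3, Thm. 4.4 and §4 p. 659] -/
theorem _root_.Literature.AlgebraicGeometry.HodgeTheory.IsPolarizationClass.mem_lefschetzGroup_iff
    (hpol : IsPolarizationClass A.dim A.X h) (hA : 1 ≤ A.dim) :
    gA ∈ lefschetzGroup A.dim A.X ↔ gA 1 ∈ similitudeCentralizerGroup A h ∧
      gA = fun k ↦ exteriorPullbackEquiv (AbelianVariety.hasExteriorCohomologyH1_complexPoints A) (gA 1) k := by
  constructor
  · intro hg
    exact ⟨(hpol.lefschetzGroup_map_one_eq hA).le ⟨gA, hg, rfl⟩, lefschetzGroup_eq_exteriorPullbackEquiv hg⟩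
  · rintro ⟨h1, e⟩
    rw [e]
    exact (hpol.exteriorPullbackEquiv_mem_lefschetzGroup_iff hA).2 h1

/-- `g ∈ ker l(A)(ℂ)` iff `g₁ ∈ S(A)(h)(ℂ)` and `g = (⋀ᵏg₁)_k`, for a rational class with a Kähler multiple (every dimension).
[cite: Milne1999LefschetzClasses, Def. 4.3 and Thm. 4.4 (p. 659)] -/
theorem mem_specialLefschetzGroup_iff_of_isKaehlerClass (hQ : IsRationalClass h)
    (hK : ∃ s : ℝ, 0 < s ∧ IsKaehlerClass A.dim A.X ((s : ℂ) • h)) :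
    gA ∈ specialLefschetzGroup A.dim A.X ↔ gA 1 ∈ unitaryCentralizerGroup A h ∧
      gA = fun k ↦ exteriorPullbackEquiv (AbelianVariety.hasExteriorCohomologyH1_complexPoints A) (gA 1) k := by
  constructor
  · intro hg
    exact ⟨(Milne1999_thm44_specialLefschetzGroup_one_eq_unitaryCentralizerGroup_holds A h hQ hK).le ⟨gA, hg, rfl⟩,
      specialLefschetzGroup_eq_exteriorPullbackEquiv hg⟩
  · rintro ⟨h1, e⟩
    rw [e]
    exact (exteriorPullbackEquiv_mem_specialLefschetzGroup_iff_of_isKaehlerClass hQ hK).2 h1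

end Membership

/-! ### §3 The family carriers as abstract groups: Thm. 4.4, Cor. 4.7, isogeny invariance -/

section Groups

variable {A B C X : AbelianVariety ℂ} {h : complexBetti A.X 2} {hB : complexBetti B.X 2} {hC : complexBetti C.X 2}

/-- **`ker l(A)(ℂ) ≅ S(A)(h)(ℂ)`** for a rational class with a Kähler multiple (every dimension): `g ↦ g₁`.
[cite: Milne1999LefschetzClasses, Thm. 4.4 (p. 659)] -/
theorem nonempty_specialLefschetzGroup_mulEquiv_unitaryCentralizerGroup_of_isKaehlerClass (hQ : IsRationalClass h)
    (hK : ∃ s : ℝ, 0 < s ∧ IsKaehlerClass A.dim A.X ((s : ℂ) • h)) :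
    Nonempty (specialLefschetzGroup A.dim A.X ≃* unitaryCentralizerGroup A h) :=
  ⟨(MulEquiv.ofBijective _ (bijective_evalOne_subgroupMap_specialLefschetzGroup A)).trans
    (MulEquiv.subgroupCongr (Milne1999_thm44_specialLefschetzGroup_one_eq_unitaryCentralizerGroup_holds A h hQ hK))⟩

/-- **`ker l(A)(ℂ) ≅ S(A)(h)(ℂ)`** for a polarization class (`dim A ≥ 1`). [cite: Milne1999LefschetzClasses, Thm. 4.4 (p. 659)] -/
theorem _root_.Literature.AlgebraicGeometry.HodgeTheory.IsPolarizationClass.nonempty_specialLefschetzGroup_mulEquiv_unitaryCentralizerGroup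
    (hpol : IsPolarizationClass A.dim A.X h) (hA : 1 ≤ A.dim) :
    Nonempty (specialLefschetzGroup A.dim A.X ≃* unitaryCentralizerGroup A h) :=
  ⟨(MulEquiv.ofBijective _ (bijective_evalOne_subgroupMap_specialLefschetzGroup A)).trans
    (MulEquiv.subgroupCongr (hpol.specialLefschetzGroup_map_one_eq hA))⟩

/-- **`L(A)(ℂ) ≅ G(A)(h)(ℂ)`** (the centraliser of `End⁰(A)` in the similitude group of the polarization form; polarization class,
`dim A ≥ 1`). [cite: Milne1999LefschetzClasses, Def. 4.3, Thm. 4.4 and §4 p. 659] -/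
theorem _root_.Literature.AlgebraicGeometry.HodgeTheory.IsPolarizationClass.nonempty_lefschetzGroup_mulEquiv_similitudeCentralizerGroup
    (hpol : IsPolarizationClass A.dim A.X h) (hA : 1 ≤ A.dim) :
    Nonempty (lefschetzGroup A.dim A.X ≃* similitudeCentralizerGroup A h) :=
  ⟨(MulEquiv.ofBijective _ (bijective_evalOne_subgroupMap_lefschetzGroup' A)).trans
    (MulEquiv.subgroupCongr (hpol.lefschetzGroup_map_one_eq hA))⟩

/-- **Cor. 4.7 for the family carrier `ker l`: `ker l(A^{r+1})(ℂ) ≅ ker l(A)(ℂ)`** (`dim A ≥ 1`).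
[cite: Milne1999LefschetzClasses, Cor. 4.7 (p. 660)] -/
theorem nonempty_specialLefschetzGroup_powSucc_mulEquiv (hA : 1 ≤ A.dim) (r : ℕ) :
    Nonempty (specialLefschetzGroup (A.powSucc r).dim (A.powSucc r).X ≃* specialLefschetzGroup A.dim A.X) := by
  obtain ⟨e⟩ := nonempty_map_specialLefschetzGroup_one_powSucc_mulEquiv A hA r
  exact ⟨(MulEquiv.ofBijective _ (bijective_evalOne_subgroupMap_specialLefschetzGroup (A.powSucc r))).trans
    (e.symm.trans (MulEquiv.ofBijective _ (bijective_evalOne_subgroupMap_specialLefschetzGroup A)).symm)⟩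

/-- **Cor. 4.7 for the family carrier `L`: `L(A^{r+1})(ℂ) ≅ L(A)(ℂ)`** (`dim A ≥ 1`). [cite: Milne1999LefschetzClasses, Cor. 4.7 (p. 660)] -/
theorem nonempty_lefschetzGroup_powSucc_mulEquiv (hA : 1 ≤ A.dim) (r : ℕ) :
    Nonempty (lefschetzGroup (A.powSucc r).dim (A.powSucc r).X ≃* lefschetzGroup A.dim A.X) := by
  obtain ⟨e⟩ := nonempty_map_lefschetzGroup_one_powSucc_mulEquiv A hA r
  exact ⟨(MulEquiv.ofBijective _ (bijective_evalOne_subgroupMap_lefschetzGroup' (A.powSucc r))).trans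
    (e.symm.trans (MulEquiv.ofBijective _ (bijective_evalOne_subgroupMap_lefschetzGroup' A)).symm)⟩

/-- **Cor. 4.7 (binary, Hom-orthogonal factors) for `ker l`: `ker l(B × C)(ℂ) ≅ ker l(B)(ℂ) × ker l(C)(ℂ)`**
(`Hom(B, C) = 0 = Hom(C, B)`, positive dimensions). [cite: Milne1999LefschetzClasses, Cor. 4.7 and §4 p. 660] -/
theorem nonempty_specialLefschetzGroup_prod_mulEquiv (hBC : ∀ f : B ⟶ C, f = 0) (hCB : ∀ g : C ⟶ B, g = 0)
    (hB1 : 1 ≤ B.dim) (hC1 : 1 ≤ C.dim) :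
    Nonempty (specialLefschetzGroup (B.prod C).dim (B.prod C).X ≃*
      specialLefschetzGroup B.dim B.X × specialLefschetzGroup C.dim C.X) := by
  obtain ⟨e⟩ := nonempty_map_specialLefschetzGroup_one_prod_mulEquiv B C hBC hCB hB1 hC1
  exact ⟨(MulEquiv.ofBijective _ (bijective_evalOne_subgroupMap_specialLefschetzGroup (B.prod C))).trans
    (e.trans (MulEquiv.prodCongr (MulEquiv.ofBijective _ (bijective_evalOne_subgroupMap_specialLefschetzGroup B)).symm
      (MulEquiv.ofBijective _ (bijective_evalOne_subgroupMap_specialLefschetzGroup C)).symm))⟩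

/-- **Def. 4.6 / Cor. 4.7 (binary, Hom-orthogonal factors) for `L`: `L(B × C)(ℂ) ≅ G(B) ×_{𝔾_m} G(C)`** (the fibre product over the
multiplier characters, `similitudeCentralizerGroupFibreProd`; polarization classes, positive dimensions).
[cite: Milne1999LefschetzClasses, Def. 4.6 and Cor. 4.7 (p. 660)] -/
theorem nonempty_lefschetzGroup_prod_mulEquiv_fibreProd (hBC : ∀ f : B ⟶ C, f = 0) (hCB : ∀ g : C ⟶ B, g = 0)
    (hpolB : IsPolarizationClass B.dim B.X hB) (hpolC : IsPolarizationClass C.dim C.X hC) (hB1 : 1 ≤ B.dim)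
    (hC1 : 1 ≤ C.dim) :
    Nonempty (lefschetzGroup (B.prod C).dim (B.prod C).X ≃* similitudeCentralizerGroupFibreProd B C hB hC) := by
  obtain ⟨e⟩ := nonempty_map_lefschetzGroup_one_prod_mulEquiv_fibreProd B C hBC hCB hpolB hpolC hB1 hC1
  exact ⟨(MulEquiv.ofBijective _ (bijective_evalOne_subgroupMap_lefschetzGroup' (B.prod C))).trans e⟩

/-- **Isogeny invariance of `ker l` as a group: `ker l(B)(ℂ) ≅ ker l(A)(ℂ)`** along an isogeny `f : A → B`.
[cite: Milne1999LefschetzClasses, §4 p. 658 (L(A) depends only on the isogeny class)] [cite: MumfordAV1970, §19 Thm. 1 (p. 174)] -/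
theorem nonempty_specialLefschetzGroup_mulEquiv_of_isIsogeny {f : A ⟶ B} (hf : AbelianVariety.IsIsogeny f) :
    Nonempty (specialLefschetzGroup B.dim B.X ≃* specialLefschetzGroup A.dim A.X) := by
  obtain ⟨e⟩ := nonempty_map_specialLefschetzGroup_one_mulEquiv_of_isIsogeny hf
  exact ⟨(MulEquiv.ofBijective _ (bijective_evalOne_subgroupMap_specialLefschetzGroup B)).trans
    (e.trans (MulEquiv.ofBijective _ (bijective_evalOne_subgroupMap_specialLefschetzGroup A)).symm)⟩

/-- `ker l(A)(ℂ) ≅ ker l(B)(ℂ)` for isogenous `A`, `B`. [cite: Milne1999LefschetzClasses, §4 p. 658] -/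
theorem nonempty_specialLefschetzGroup_mulEquiv_of_isIsogenous (hAB : AbelianVariety.IsIsogenous A B) :
    Nonempty (specialLefschetzGroup A.dim A.X ≃* specialLefschetzGroup B.dim B.X) := by
  obtain ⟨f, hf⟩ := hAB
  obtain ⟨e⟩ := nonempty_specialLefschetzGroup_mulEquiv_of_isIsogeny hf
  exact ⟨e.symm⟩

/-- **Isogeny invariance of `L` as a group: `L(B)(ℂ) ≅ L(A)(ℂ)`** along an isogeny `f : A → B`.
[cite: Milne1999LefschetzClasses, §4 p. 658] [cite: MumfordAV1970, §19 Thm. 1 (p. 174)] -/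
theorem nonempty_lefschetzGroup_mulEquiv_of_isIsogeny {f : A ⟶ B} (hf : AbelianVariety.IsIsogeny f) :
    Nonempty (lefschetzGroup B.dim B.X ≃* lefschetzGroup A.dim A.X) := by
  obtain ⟨e⟩ := nonempty_map_lefschetzGroup_one_mulEquiv_of_isIsogeny hf
  exact ⟨(MulEquiv.ofBijective _ (bijective_evalOne_subgroupMap_lefschetzGroup' B)).trans
    (e.trans (MulEquiv.ofBijective _ (bijective_evalOne_subgroupMap_lefschetzGroup' A)).symm)⟩

/-- `L(A)(ℂ) ≅ L(B)(ℂ)` for isogenous `A`, `B`. [cite: Milne1999LefschetzClasses, §4 p. 658] -/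
theorem nonempty_lefschetzGroup_mulEquiv_of_isIsogenous (hAB : AbelianVariety.IsIsogenous A B) :
    Nonempty (lefschetzGroup A.dim A.X ≃* lefschetzGroup B.dim B.X) := by
  obtain ⟨e⟩ := nonempty_map_lefschetzGroup_one_mulEquiv_of_isIsogenous hAB
  exact ⟨(MulEquiv.ofBijective _ (bijective_evalOne_subgroupMap_lefschetzGroup' A)).trans
    (e.trans (MulEquiv.ofBijective _ (bijective_evalOne_subgroupMap_lefschetzGroup' B)).symm)⟩

/-- **Prop. 1.5 for `ker l`: `X ∼ A^{r+1}` gives `ker l(X)(ℂ) ≅ ker l(A)(ℂ)`** (`dim A ≥ 1`).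
[cite: Milne1999LefschetzClasses, Prop. 1.5 (p. 644) and Cor. 4.7 (p. 660)] -/
theorem nonempty_specialLefschetzGroup_mulEquiv_of_isIsogenous_powSucc (hA : 1 ≤ A.dim) (r : ℕ)
    (hX : AbelianVariety.IsIsogenous X (A.powSucc r)) :
    Nonempty (specialLefschetzGroup X.dim X.X ≃* specialLefschetzGroup A.dim A.X) := by
  obtain ⟨e₁⟩ := nonempty_specialLefschetzGroup_mulEquiv_of_isIsogenous hX
  obtain ⟨e₂⟩ := nonempty_specialLefschetzGroup_powSucc_mulEquiv hA r
  exact ⟨e₁.trans e₂⟩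

/-- **Prop. 1.5 for `L`: `X ∼ A^{r+1}` gives `L(X)(ℂ) ≅ L(A)(ℂ)`** (`dim A ≥ 1`). [cite: Milne1999LefschetzClasses, Prop. 1.5 (p. 644) and Cor. 4.7 (p. 660)] -/
theorem nonempty_lefschetzGroup_mulEquiv_of_isIsogenous_powSucc (hA : 1 ≤ A.dim) (r : ℕ)
    (hX : AbelianVariety.IsIsogenous X (A.powSucc r)) :
    Nonempty (lefschetzGroup X.dim X.X ≃* lefschetzGroup A.dim A.X) := by
  obtain ⟨e₁⟩ := nonempty_lefschetzGroup_mulEquiv_of_isIsogenous hX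
  obtain ⟨e₂⟩ := nonempty_lefschetzGroup_powSucc_mulEquiv hA r
  exact ⟨e₁.trans e₂⟩

/-- **Prop. 1.5 for `ker l`, two Hom-orthogonal types: `X ∼ B^{r+1} × C^{s+1}` gives `ker l(X)(ℂ) ≅ ker l(B)(ℂ) × ker l(C)(ℂ)`**.
[cite: Milne1999LefschetzClasses, Prop. 1.5 (p. 644) and Cor. 4.7 (p. 660)] -/
theorem nonempty_specialLefschetzGroup_mulEquiv_prod_of_isIsogenous_powSucc_prod_powSucc (hBC : ∀ f : B ⟶ C, f = 0)
    (hCB : ∀ g : C ⟶ B, g = 0) (hB1 : 1 ≤ B.dim) (hC1 : 1 ≤ C.dim) (r s : ℕ)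
    (hX : AbelianVariety.IsIsogenous X ((B.powSucc r).prod (C.powSucc s))) :
    Nonempty (specialLefschetzGroup X.dim X.X ≃* specialLefschetzGroup B.dim B.X × specialLefschetzGroup C.dim C.X) := by
  obtain ⟨e⟩ := nonempty_map_specialLefschetzGroup_one_mulEquiv_prod_of_isIsogenous_powSucc_prod_powSucc B C hBC hCB hB1 hC1 r s hX
  exact ⟨(MulEquiv.ofBijective _ (bijective_evalOne_subgroupMap_specialLefschetzGroup X)).trans
    (e.trans (MulEquiv.prodCongr (MulEquiv.ofBijective _ (bijective_evalOne_subgroupMap_specialLefschetzGroup B)).symm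
      (MulEquiv.ofBijective _ (bijective_evalOne_subgroupMap_specialLefschetzGroup C)).symm))⟩

/-- **Prop. 1.5 for `L`, two Hom-orthogonal types: `X ∼ B^{r+1} × C^{s+1}` gives `L(X)(ℂ) ≅ G(B) ×_{𝔾_m} G(C)`**
(polarization classes). [cite: Milne1999LefschetzClasses, Prop. 1.5 (p. 644), Def. 4.6 and Cor. 4.7 (p. 660)] -/
theorem nonempty_lefschetzGroup_mulEquiv_fibreProd_of_isIsogenous_powSucc_prod_powSucc (hBC : ∀ f : B ⟶ C, f = 0)
    (hCB : ∀ g : C ⟶ B, g = 0) (hpolB : IsPolarizationClass B.dim B.X hB) (hpolC : IsPolarizationClass C.dim C.X hC)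
    (hB1 : 1 ≤ B.dim) (hC1 : 1 ≤ C.dim) (r s : ℕ) (hX : AbelianVariety.IsIsogenous X ((B.powSucc r).prod (C.powSucc s))) :
    Nonempty (lefschetzGroup X.dim X.X ≃* similitudeCentralizerGroupFibreProd B C hB hC) := by
  obtain ⟨e⟩ := nonempty_map_lefschetzGroup_one_mulEquiv_fibreProd_of_isIsogenous_powSucc_prod_powSucc hBC hCB hpolB hpolC
    hB1 hC1 r s hX
  exact ⟨(MulEquiv.ofBijective _ (bijective_evalOne_subgroupMap_lefschetzGroup' X)).trans e⟩

end Groups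

end Literature.AlgebraicGeometry.Milne1999
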